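import Summits.Schanuel.Schanuel.Theorems.ZilberEacBoundedBranchGeneral
import HarnessLib

/-!
# Arbitrary base branches, LXX: graphs of RATIONAL FUNCTIONS bounded at infinity — the `x₁`-degree
# `1` case of the bounded-branch theorem

HONEST FRAMING.  Cell `pub-schanuel` (Zilber's Exponential-Algebraic Closedness, case ladder;
host summit Schanuel), seat 2, gen 31.  The base curves of `x₁`-degree `1`, `F = a(x₀)x₁ + b(x₀)`
irreducible, are the graphs `x₁ = -b(x₀)/a(x₀)`.  When `a` is non-constant and `deg b ≤ deg a` the
graph has a horizontal asymptote (`x₁ → -lc(b)/lc(a)` or `0` as `x₀ → ∞`) and is not a line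
(the rows `a, b` have no common root, so `-b/a` is not affine-linear); the bounded-branch engine of
file LXVIII (a) applies.  **`unprojectedDensityQuestion_rationalGraph_polyFibre`**: for every
`R ∈ ℂ[x₀, x₁]` nonzero somewhere on the graph, `{a(x₀)x₁ + b(x₀) = 0, y₀ = R(x₀, x₁)}` is in
Mantova–Masser's case and has Zariski-dense exponential points — e.g. the hyperbola `x₀x₁ = 1`,
`x₁ = x₀/(x₀² + 1)`, `x₁ = (x₀ + 1)/(x₀ - 1)` (earlier gens decided Laurent-monomial graphs by hand).
Decided instances of an OPEN question (Mantova–Masser, PLMS 2024 §1 p. 5); EC(3,2) OPEN; NOT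
Schanuel's conjecture (neither used nor implied); EAC ⇏ SC.
-/

noncomputable section

open Filter Topology Set Complex Polynomial
open Literature.NumberTheory.Transcendental Literature.ModelTheory.Zilber
open Literature.ModelTheory.ExponentialFields

set_option linter.dupNamespace false

namespace Summit.Schanuel.Schanuel.Theorems

section RationalGraph

variable (a b : ℂ[X])

/-- Evaluation of `F = a(x₀)x₁ + b(x₀)`. [folklore] -/
theorem eval_rationalGraph (x y : ℂ) :
    ((Polynomial.C a * X + Polynomial.C b : ℂ[X][X]).map (Polynomial.evalRingHom x)).eval y =
      a.eval x * y + b.eval x := by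
  simp

/-- `F = a x₁ + b` with `a ≠ 0` has `x₁`-degree `1`. [folklore] -/
theorem natDegree_rationalGraph (ha : a ≠ 0) :
    (Polynomial.C a * X + Polynomial.C b : ℂ[X][X]).natDegree = 1 := by
  rw [Polynomial.natDegree_add_eq_left_of_natDegree_lt] <;>
    rw [Polynomial.natDegree_C_mul_X _ ha]
  rw [Polynomial.natDegree_C]; exact zero_lt_one

/-- The rows of an irreducible `a x₁ + b` have no common root. [folklore] -/
theorem rationalGraph_no_common_root (hirr : Irreducible (Polynomial.C a * X + Polynomial.C b : ℂ[X][X]))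
    (ha : a ≠ 0) (c : ℂ) : ¬ (a.IsRoot c ∧ b.IsRoot c) := by
  rintro ⟨hac, hbc⟩
  obtain ⟨j, hj⟩ := exists_coeff_not_isRoot_of_irreducible hirr
    (by rw [natDegree_rationalGraph a b ha]; exact one_ne_zero) c
  apply hj
  rcases j with _ | _ | j
  · simpa using hbc
  · simpa using hac
  · simp

/-- **The graph of `-b/a` (`a` non-constant) contains no horizontal line and, more precisely,
`F(·, y) ≢ 0` for every `y`.** [folklore] -/
theorem rationalGraph_not_horizontal (hirr : Irreducible (Polynomial.C a * X + Polynomial.C b : ℂ[X][X]))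
    (ha : 1 ≤ a.natDegree) (y : ℂ) :
    ∃ c : ℂ, ((Polynomial.C a * X + Polynomial.C b : ℂ[X][X]).map (Polynomial.evalRingHom c)).eval y ≠ 0 := by
  have ha0 : a ≠ 0 := by rintro rfl; rw [Polynomial.natDegree_zero] at ha; exact Nat.not_succ_le_zero 0 ha
  by_contra hall
  push Not at hall
  have hP : Polynomial.C y * a + b = 0 := by
    refine Polynomial.funext fun c => ?_
    have := hall c
    rw [eval_rationalGraph] at this
    simp only [Polynomial.eval_add, Polynomial.eval_mul, Polynomial.eval_C, Polynomial.eval_zero]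
    linear_combination this
  -- a root of `a` is then a root of `b`
  obtain ⟨r, hr⟩ := Complex.exists_root (Polynomial.degree_pos_of_ne_zero_of_nonunit ha0 (by
    rw [Polynomial.isUnit_iff_degree_eq_zero, Polynomial.degree_eq_natDegree ha0]
    exact_mod_cast (by omega : a.natDegree ≠ 0)))
  refine rationalGraph_no_common_root a b hirr ha0 r ⟨hr, ?_⟩
  have := congrArg (Polynomial.eval r) hP
  simp only [Polynomial.eval_add, Polynomial.eval_mul, Polynomial.eval_C, Polynomial.eval_zero,
    hr.eq_zero, mul_zero, zero_add] at this
  exact this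

/-- **The graph of `-b/a` (`a` non-constant, irreducible) lies on no line.** [folklore] -/
theorem rationalGraph_exists_offLine (hirr : Irreducible (Polynomial.C a * X + Polynomial.C b : ℂ[X][X]))
    (ha : 1 ≤ a.natDegree) (m : Fin 2 → ℤ) (hm : m ≠ 0) (c₀ : ℂ) :
    ∃ x y : ℂ, ((Polynomial.C a * X + Polynomial.C b : ℂ[X][X]).map (Polynomial.evalRingHom x)).eval y = 0 ∧
      (m 0 : ℂ) * x + (m 1 : ℂ) * y ≠ c₀ := by
  classical
  have ha0 : a ≠ 0 := by rintro rfl; rw [Polynomial.natDegree_zero] at ha; exact Nat.not_succ_le_zero 0 ha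
  by_contra hall
  push Not at hall
  -- on the cofinite set `a(x) ≠ 0` the graph point is `(x, -b(x)/a(x))`
  have hpt : ∀ x : ℂ, a.eval x ≠ 0 → (m 0 : ℂ) * x + (m 1 : ℂ) * (-b.eval x / a.eval x) = c₀ := by
    intro x hx
    refine hall x _ ?_
    rw [eval_rationalGraph]
    field_simp
    ring
  -- hence the polynomial `m₀ X a - m₁ b - c₀ a` has infinitely many roots
  set P : ℂ[X] := Polynomial.C (m 0 : ℂ) * X * a - Polynomial.C (m 1 : ℂ) * b - Polynomial.C c₀ * a
    with hPdef
  have hProots : ∀ x : ℂ, a.eval x ≠ 0 → P.IsRoot x := by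
    intro x hx
    have h := hpt x hx
    rw [Polynomial.IsRoot, hPdef]
    simp only [Polynomial.eval_sub, Polynomial.eval_mul, Polynomial.eval_C, Polynomial.eval_X]
    field_simp at h
    linear_combination h
  have hP0 : P = 0 := by
    refine Polynomial.eq_zero_of_infinite_isRoot P ?_
    refine ((Polynomial.finite_setOf_isRoot ha0).infinite_compl).mono fun x hx => hProots x hx
  -- evaluate at a root of `a`
  obtain ⟨r, hr⟩ := Complex.exists_root (Polynomial.degree_pos_of_ne_zero_of_nonunit ha0 (by
    rw [Polynomial.isUnit_iff_degree_eq_zero, Polynomial.degree_eq_natDegree ha0]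
    exact_mod_cast (by omega : a.natDegree ≠ 0)))
  have hbr : (m 1 : ℂ) * b.eval r = 0 := by
    have := congrArg (Polynomial.eval r) hP0
    simp only [hPdef, Polynomial.eval_sub, Polynomial.eval_mul, Polynomial.eval_C, Polynomial.eval_X,
      hr.eq_zero, mul_zero, Polynomial.eval_zero, zero_sub, sub_zero] at this
    linear_combination -this
  rcases mul_eq_zero.1 hbr with hm1 | hb
  · -- `m₁ = 0`: the line is vertical, but the graph has points over two values of `x₀`
    have hm0 : (m 0 : ℂ) ≠ 0 := by
      intro h0
      apply hm
      funext i
      fin_cases i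
      · exact_mod_cast h0
      · exact_mod_cast hm1
    obtain ⟨x₁, hx₁⟩ := ((Polynomial.finite_setOf_isRoot ha0).union (Set.finite_singleton (c₀ / (m 0 : ℂ)))).infinite_compl.nonempty
    simp only [Set.mem_compl_iff, Set.mem_union, Set.mem_setOf_eq, Set.mem_singleton_iff, not_or] at hx₁
    have h := hpt x₁ hx₁.1
    rw [hm1, zero_mul, add_zero] at h
    apply hx₁.2
    rw [← h]; field_simp
  · exact rationalGraph_no_common_root a b hirr ha0 r ⟨hr, hb⟩

/-- **Mantova–Masser's case for polynomial fibres over a rational graph.** [folklore] (new) -/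
theorem mmCase_rationalGraph_polyFibre (hirr : Irreducible (Polynomial.C a * X + Polynomial.C b : ℂ[X][X]))
    (ha : 1 ≤ a.natDegree) (R : MvPolynomial (Fin 2) ℂ)
    (hR : ∃ x y : ℂ, ((Polynomial.C a * X + Polynomial.C b : ℂ[X][X]).map (Polynomial.evalRingHom x)).eval y = 0 ∧
      MvPolynomial.eval ![x, y] R ≠ 0) :
    MMCaseDimPiOneFree {w : Fin 2 ⊕ Fin 2 → ℂ |
      ((Polynomial.C a * X + Polynomial.C b : ℂ[X][X]).map (Polynomial.evalRingHom (w (Sum.inl 0)))).eval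
          (w (Sum.inl 1)) = 0 ∧
      w (Sum.inr 0) = MvPolynomial.eval ![w (Sum.inl 0), w (Sum.inl 1)] R} := by
  classical
  set F : ℂ[X][X] := Polynomial.C a * X + Polynomial.C b with hF
  obtain ⟨Φr, hΦr⟩ := exists_rowsEquiv
  set A : MvPolynomial (Fin 2) ℂ := Φr.symm F with hA
  have hPQ : ∀ x y : ℂ, MvPolynomial.eval ![x, y] A = (F.map (Polynomial.evalRingHom x)).eval y := by
    intro x y
    rw [hΦr, hA, RingEquiv.apply_symm_apply]
  have hirrA : Irreducible A := (irreducible_rows_iff hPQ).2 hirr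
  have hset : {w : Fin 2 ⊕ Fin 2 → ℂ |
      (F.map (Polynomial.evalRingHom (w (Sum.inl 0)))).eval (w (Sum.inl 1)) = 0 ∧
      w (Sum.inr 0) = MvPolynomial.eval ![w (Sum.inl 0), w (Sum.inl 1)] R} =
      {w : Fin 2 ⊕ Fin 2 → ℂ | MvPolynomial.eval ![w (Sum.inl 0), w (Sum.inl 1)] A = 0 ∧
        w (Sum.inr 0) = MvPolynomial.eval ![w (Sum.inl 0), w (Sum.inl 1)] R} := by
    ext w
    simp only [Set.mem_setOf_eq, hPQ]
  rw [hset]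
  refine mmCase_curveGraphFibre hirrA ?_ ?_
  · obtain ⟨x, y, hxy, hne⟩ := hR
    exact ⟨![x, y], by rw [hPQ]; exact hxy, hne⟩
  · intro m hm c₀
    obtain ⟨x, y, hxy, hne⟩ := rationalGraph_exists_offLine a b hirr ha m hm c₀
    exact ⟨![x, y], by rw [hPQ]; exact hxy, by simpa using hne⟩

/-- **Polynomial fibres over the graph of a rational function bounded at infinity: case ∧ dense.**
`F = a(x₀)x₁ + b(x₀)` irreducible with `a` non-constant and `deg b ≤ deg a`; `R` nonzero somewhere
on the graph.  (The bounded place: `x₀ = s^{-1}`, `x₁ = -U_b(s)s^{deg a - deg b}/U_a(s)` from the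
polar forms of `a, b`.) [cite: MantovaMasser2023, §1 Further remarks, p. 5 (the question, open in
general)] (new) -/
theorem unprojectedDensityQuestion_rationalGraph_polyFibre
    (hirr : Irreducible (Polynomial.C a * X + Polynomial.C b : ℂ[X][X])) (ha : 1 ≤ a.natDegree)
    (hdeg : b.natDegree ≤ a.natDegree) (R : MvPolynomial (Fin 2) ℂ)
    (hR : ∃ x y : ℂ, ((Polynomial.C a * X + Polynomial.C b : ℂ[X][X]).map (Polynomial.evalRingHom x)).eval y = 0 ∧
      MvPolynomial.eval ![x, y] R ≠ 0) :
    MMCaseDimPiOneFree {w : Fin 2 ⊕ Fin 2 → ℂ |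
        ((Polynomial.C a * X + Polynomial.C b : ℂ[X][X]).map (Polynomial.evalRingHom (w (Sum.inl 0)))).eval
            (w (Sum.inl 1)) = 0 ∧
        w (Sum.inr 0) = MvPolynomial.eval ![w (Sum.inl 0), w (Sum.inl 1)] R} ∧
      UnprojectedDense {w : Fin 2 ⊕ Fin 2 → ℂ |
        ((Polynomial.C a * X + Polynomial.C b : ℂ[X][X]).map (Polynomial.evalRingHom (w (Sum.inl 0)))).eval
            (w (Sum.inl 1)) = 0 ∧
        w (Sum.inr 0) = MvPolynomial.eval ![w (Sum.inl 0), w (Sum.inl 1)] R} := by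
  classical
  refine ⟨mmCase_rationalGraph_polyFibre a b hirr ha R hR, ?_⟩
  set F : ℂ[X][X] := Polynomial.C a * X + Polynomial.C b with hF
  have ha0 : a ≠ 0 := by rintro rfl; rw [Polynomial.natDegree_zero] at ha; exact Nat.not_succ_le_zero 0 ha
  obtain ⟨Φr, hΦr⟩ := exists_rowsEquiv
  set A : MvPolynomial (Fin 2) ℂ := Φr.symm F with hA
  have hPQ : ∀ x y : ℂ, MvPolynomial.eval ![x, y] A = (F.map (Polynomial.evalRingHom x)).eval y := by
    intro x y
    rw [hΦr, hA, RingEquiv.apply_symm_apply]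
  have hirrA : Irreducible A := (irreducible_rows_iff hPQ).2 hirr
  have hset : {w : Fin 2 ⊕ Fin 2 → ℂ |
      (F.map (Polynomial.evalRingHom (w (Sum.inl 0)))).eval (w (Sum.inl 1)) = 0 ∧
      w (Sum.inr 0) = MvPolynomial.eval ![w (Sum.inl 0), w (Sum.inl 1)] R} =
      {w : Fin 2 ⊕ Fin 2 → ℂ | MvPolynomial.eval ![w (Sum.inl 0), w (Sum.inl 1)] A = 0 ∧
        w (Sum.inr 0) = MvPolynomial.eval ![w (Sum.inl 0), w (Sum.inl 1)] R} := by
    ext w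
    simp only [Set.mem_setOf_eq, hPQ]
  rw [hset]
  have hS := isIrreducibleClosed_curveGraphFibre R hirrA
  have hdim := zariskiDim_curveGraphFibre R hirrA
  -- the bounded place `x₀ = s⁻¹`, `x₁ = -U_b(s) s^{deg a - deg b} / U_a(s)`
  obtain ⟨Ua, hUaan, hUa0, hUaev⟩ := exists_polarForm_eval a (U := fun _ : ℂ => (1 : ℂ)) analyticAt_const le_rfl
  obtain ⟨Ub, hUban, -, hUbev⟩ := exists_polarForm_eval b (U := fun _ : ℂ => (1 : ℂ)) analyticAt_const le_rfl
  rw [one_pow, mul_one] at hUa0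
  have hUa0' : Ua 0 ≠ 0 := by rw [hUa0]; exact Polynomial.leadingCoeff_ne_zero.2 ha0
  have hUane : ∀ᶠ s in 𝓝 (0 : ℂ), Ua s ≠ 0 := hUaan.continuousAt.eventually_ne hUa0'
  set Φ : ℂ → ℂ := fun s => -(Ub s * s ^ (a.natDegree - b.natDegree)) / Ua s with hΦ
  have hΦan : AnalyticAt ℂ Φ 0 :=
    ((hUban.mul (analyticAt_id.pow _)).neg).div hUaan hUa0'
  have hplace : ∀ᶠ s in 𝓝[≠] (0 : ℂ), (F.map (Polynomial.evalRingHom (s ^ 1)⁻¹)).eval (Φ s) = 0 := by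
    filter_upwards [self_mem_nhdsWithin, nhdsWithin_le_nhds hUane] with s (hs0 : s ≠ 0) hUas
    rw [hF, eval_rationalGraph, pow_one]
    have ha' := hUaev s hs0
    have hb' := hUbev s hs0
    rw [one_mul, one_mul] at ha' hb'
    rw [show (s⁻¹ : ℂ) = s⁻¹ ^ 1 by rw [pow_one], ha', hb']
    simp only [hΦ]
    have key : (s : ℂ) ^ (a.natDegree - b.natDegree) * s⁻¹ ^ a.natDegree = s⁻¹ ^ b.natDegree := by
      rw [inv_pow, inv_pow]
      have hsa : s ^ a.natDegree = s ^ (a.natDegree - b.natDegree) * s ^ b.natDegree := by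
        rw [← pow_add, Nat.sub_add_cancel hdeg]
      rw [hsa, mul_inv, ← mul_assoc, mul_inv_cancel₀ (pow_ne_zero _ hs0), one_mul]
    have h1 : Ua s * s⁻¹ ^ a.natDegree * (-(Ub s * s ^ (a.natDegree - b.natDegree)) / Ua s) =
        -(Ub s * (s ^ (a.natDegree - b.natDegree) * s⁻¹ ^ a.natDegree)) := by
      field_simp
    rw [h1, key]
    ring
  have hF1 : 1 ≤ F.natDegree := by rw [hF, natDegree_rationalGraph a b ha0]
  have hndvd : ¬ F ∣ Φr R := by
    refine not_dvd_of_exists_eval_ne_zero F ?_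
    obtain ⟨x, y, hxy, hne⟩ := hR
    exact ⟨x, y, hxy, by rw [← hΦr]; exact hne⟩
  have hplace' : ∀ᶠ s in 𝓝[≠] (0 : ℂ),
      (F.map (Polynomial.evalRingHom (s ^ 1)⁻¹)).eval (Φ s * (s ^ 0)⁻¹) = 0 := by
    filter_upwards [hplace] with s hs
    rwa [pow_zero, inv_one, mul_one]
  obtain ⟨ψ, L, hψan, hψ0, hf⟩ :=
    exists_rows_place_normalForm F hirr hF1 (Φr R) hndvd le_rfl 0 hΦan hplace'
  refine unprojectedDense_boundedBranch' F hS (le_of_eq hdim) hirr hF1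
    (rationalGraph_not_horizontal a b hirr ha) le_rfl hΦan hplace L hψan hψ0 ?_
  filter_upwards [hplace, hf] with s hs hfs
  rw [pow_zero, inv_one, mul_one] at hfs
  refine ⟨?_, ?_⟩
  · simp only [Sum.elim_inl, Matrix.cons_val_zero, Matrix.cons_val_one]
    rw [hPQ]
    exact hs
  · simp only [Sum.elim_inr, Sum.elim_inl, Matrix.cons_val_zero, Matrix.cons_val_one]
    rw [hΦr, hfs]

/-- **Example: the hyperbola `x₀x₁ = 1` with any polynomial fibre** (`a = X`, `b = -1`).
[cite: MantovaMasser2023, §1 Further remarks, p. 5 (the question, open in general)] (new) -/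
theorem unprojectedDensityQuestion_hyperbolaGraph_polyFibre (R : MvPolynomial (Fin 2) ℂ)
    (hR : ∃ x y : ℂ, x * y - 1 = 0 ∧ MvPolynomial.eval ![x, y] R ≠ 0) :
    MMCaseDimPiOneFree {w : Fin 2 ⊕ Fin 2 → ℂ |
        w (Sum.inl 0) * w (Sum.inl 1) - 1 = 0 ∧
        w (Sum.inr 0) = MvPolynomial.eval ![w (Sum.inl 0), w (Sum.inl 1)] R} ∧
      UnprojectedDense {w : Fin 2 ⊕ Fin 2 → ℂ |
        w (Sum.inl 0) * w (Sum.inl 1) - 1 = 0 ∧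
        w (Sum.inr 0) = MvPolynomial.eval ![w (Sum.inl 0), w (Sum.inl 1)] R} := by
  have hev : ∀ x y : ℂ, ((Polynomial.C (X : ℂ[X]) * X + Polynomial.C (-1 : ℂ[X]) : ℂ[X][X]).map
      (Polynomial.evalRingHom x)).eval y = x * y - 1 := by
    intro x y; rw [eval_rationalGraph]; simp; ring
  have hset : {w : Fin 2 ⊕ Fin 2 → ℂ | w (Sum.inl 0) * w (Sum.inl 1) - 1 = 0 ∧
      w (Sum.inr 0) = MvPolynomial.eval ![w (Sum.inl 0), w (Sum.inl 1)] R} =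
      {w : Fin 2 ⊕ Fin 2 → ℂ |
        ((Polynomial.C (X : ℂ[X]) * X + Polynomial.C (-1 : ℂ[X]) : ℂ[X][X]).map
          (Polynomial.evalRingHom (w (Sum.inl 0)))).eval (w (Sum.inl 1)) = 0 ∧
        w (Sum.inr 0) = MvPolynomial.eval ![w (Sum.inl 0), w (Sum.inl 1)] R} := by
    ext w; simp only [Set.mem_setOf_eq, hev]
  rw [hset]
  -- irreducibility: `X·x₁ - 1` is primitive of degree one
  have hirr : Irreducible (Polynomial.C (X : ℂ[X]) * X + Polynomial.C (-1 : ℂ[X]) : ℂ[X][X]) := by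
    have hprim : (Polynomial.C (X : ℂ[X]) * X + Polynomial.C (-1 : ℂ[X]) : ℂ[X][X]).IsPrimitive := by
      intro r hr
      rw [Polynomial.C_dvd_iff_dvd_coeff] at hr
      have h0 := hr 0
      simp only [Polynomial.coeff_add, Polynomial.coeff_C_mul, Polynomial.coeff_X_zero, mul_zero,
        Polynomial.coeff_C_zero, zero_add] at h0
      exact isUnit_of_dvd_one (dvd_neg.1 h0)
    refine (hprim.irreducible_iff_irreducible_map_fraction_map (K := FractionRing ℂ[X])).2 ?_
    rw [Polynomial.map_add, Polynomial.map_mul, Polynomial.map_C, Polynomial.map_X, Polynomial.map_C]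
    refine Polynomial.irreducible_of_degree_eq_one ?_
    refine Polynomial.degree_linear ?_
    rw [Ne, FaithfulSMul.algebraMap_eq_zero_iff]
    exact Polynomial.X_ne_zero
  refine unprojectedDensityQuestion_rationalGraph_polyFibre X (-1) hirr (by simp) (by simp) R ?_
  obtain ⟨x, y, hxy, hne⟩ := hR
  exact ⟨x, y, by rw [hev]; exact hxy, hne⟩

end RationalGraph

end Summit.Schanuel.Schanuel.Theorems

end
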